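import Mathlib
import Literature.Computability.AlgebraicComplexity.ValiantClasses
import Summits.ValiantsHypothesis.ValiantsHypothesis.Theorems.BarrierLeverSuccinctHittingSetsForVPGeneratorFour
import HarnessLib

/-!
# Crux `BarrierLever.DefinableEquations` (stmt-ValiantsHypothesis-8745) / item 8749
`SingleSizeEquations` — the GENERATOR WALL at exponent 4: no Boolean-sum witness at `b ≥ 4` is a
read-once formula or a product of sparse polynomials in the coefficient variables

Seat val-np-p5 g19 (docket 8745/8746/8749). In the crux's own currency — a witness of
`SingleSizeEquations` at `(n, b)` is a Boolean sum `E = boolSum H ≠ 0` in the `N = C(2n,n)`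
coefficient variables vanishing at `coeff(f)` for every `f ∈ SmallCircuits ℂ n b` — this file records
what the 14610-side rows landed today (`…GeneratorFour`: the succinct Shpilka–Volkovich generator
realised at exponent `4` by the fast separable engine `…SeparableCoeffFast`) say about the SHAPE of
such a witness:

* `boolSum_witness_not_prop_four` : for `n ≥ 8192` and every `b ≥ 4`, NO witness `E` (any `q`, any
  size and degree of `H`) is, as a polynomial in the coefficient variables, computed by a preprocessed
  read-once formula (`IsPROP S E`; any size, any degree) — tree: `b ≥ 5` (`readOnceHit_five`);
* `boolSum_witness_not_sparseProduct_four` : for every `a`, eventually in `n`, for every `b ≥ 4`, NO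
  witness is a finite product of polynomials with at most `N^a` monomials each (e.g. a `ΠΣ` / `ΠΣΠ`
  expression with `poly(N)`-sparse product gates) — tree: `b ≥ 5`;
* level forms `prop_boolSum_not_equation_four`, `sparseProduct_boolSum_not_equation_four`.

So the doors "E a read-once formula in the c's" and "E a product of poly(N)-sparse polynomials" of
the door table (memo LANDSCAPE-8749-g16 §5) are CLOSED at `b ≥ 4` and remain OPEN at `b = 2, 3`
(the generator needs `≈ 2n` seeds of size `≈ 2n²` each; a single sparse `E` is closed at `b = 2`
by `SparsityWall`).

Honest framing: a WALL (it excludes witnesses of a specific algebraic shape); the verdict on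
8745/8749 is unchanged (OPEN at `b = 2`, Chatterjee–Tengse 2023 §1.3 direction 2); nothing here bears
on `VP ≠ VNP`.

References: [ForbesShpilkaVolk2018] §3, Construction 29, Cor. 34, Question 6;
[ShpilkaVolkovich2015] Thm. 1; [ChatterjeeTengse2023] §1.3.
-/

-- layout Summits/ValiantsHypothesis/ValiantsHypothesis forces the duplicated namespace component
set_option linter.dupNamespace false

noncomputable section

namespace Summit.ValiantsHypothesis.ValiantsHypothesis.Theorems.BarrierLeverDefinableEquations

open Literature.Barriers.ValiantsHypothesis Literature.Computability.AlgebraicComplexity MvPolynomial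
open Summit.ValiantsHypothesis.ValiantsHypothesis.Theorems.BarrierLever.SuccinctHittingSetsForVP

namespace GeneratorWall

/-- **No Boolean-sum witness at `(n, b)`, `b ≥ 4`, `n ≥ 8192`, is a preprocessed read-once formula
in the coefficient variables** (any `q`, size, degree of `H`; any preprocessing).
[cite: ForbesShpilkaVolk2018, §3] -/
theorem boolSum_witness_not_prop_four {n b q : ℕ} (hn : 8192 ≤ n) (hb : 4 ≤ b)
    (H : MvPolynomial (degLEMonomials n ⊕ Fin q) ℂ) (hne : boolSum H ≠ 0)
    (hvan : ∀ f ∈ SmallCircuits ℂ n b,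
      MvPolynomial.eval (coeffVector (degLEMonomials n) f) (boolSum H) = 0) :
    ¬ ∃ S : Finset (degLEMonomials n), IsPROP S (boolSum H) := by
  rintro ⟨S, hS⟩
  obtain ⟨f, hf, hf0⟩ := readOnceHit_four_of_le hn (boolSum H) ⟨S, hS⟩ hne
  exact hf0 (hvan f (smallCircuits_mono ℂ hb (by omega) hf))

/-- **Level form**: a Boolean sum that IS a preprocessed read-once formula fails to vanish on
`SmallCircuits ℂ n b` for every `b ≥ 4`, `n ≥ 8192` — whatever `a`, `q ≤ N^a`, size and degree.
[cite: ForbesShpilkaVolk2018, §3] -/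
theorem prop_boolSum_not_equation_four {n b q : ℕ} (hn : 8192 ≤ n) (hb : 4 ≤ b)
    (H : MvPolynomial (degLEMonomials n ⊕ Fin q) ℂ) (S : Finset (degLEMonomials n))
    (hS : IsPROP S (boolSum H)) (hne : boolSum H ≠ 0) :
    ∃ f ∈ SmallCircuits ℂ n b,
      MvPolynomial.eval (coeffVector (degLEMonomials n) f) (boolSum H) ≠ 0 := by
  obtain ⟨f, hf, hf0⟩ := readOnceHit_four_of_le hn (boolSum H) ⟨S, hS⟩ hne
  exact ⟨f, smallCircuits_mono ℂ hb (by omega) hf, hf0⟩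

/-- **No Boolean-sum witness at `(n, b)`, `b ≥ 4`, `n ≥ max 8192 (10a + 2)`, is a finite product of
`N^a`-sparse polynomials in the coefficient variables** (e.g. a `ΠΣ` / `ΠΣΠ` expression with
`poly(N)`-sparse product gates; any `q`, size, degree of `H`). [cite: ForbesShpilkaVolk2018, Cor. 34] -/
theorem boolSum_witness_not_sparseProduct_four {a n b q : ℕ} (hn : 8192 ≤ n) (hna : 10 * a + 2 ≤ n)
    (hb : 4 ≤ b) (H : MvPolynomial (degLEMonomials n ⊕ Fin q) ℂ) (hne : boolSum H ≠ 0)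
    (hvan : ∀ f ∈ SmallCircuits ℂ n b,
      MvPolynomial.eval (coeffVector (degLEMonomials n) f) (boolSum H) = 0) :
    ¬ ∃ (k : ℕ) (E : Fin k → MvPolynomial (degLEMonomials n) ℂ),
        boolSum H = ∏ j, E j ∧ ∀ j, (E j).support.card ≤ Nat.choose (2 * n) n ^ a := by
  rintro ⟨k, E, hE, hEa⟩
  obtain ⟨f, hf, hf0⟩ :=
    isSuccinctHittingSet_sparseProducts_four_of_le hn hna (boolSum H) ⟨k, E, hE, hEa⟩ hne
  exact hf0 (hvan f (smallCircuits_mono ℂ hb (by omega) hf))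

/-- **Level form**: a Boolean sum that IS a product of `N^a`-sparse polynomials fails to vanish on
`SmallCircuits ℂ n b` for every `b ≥ 4`, `n ≥ max 8192 (10a + 2)`. [cite: ForbesShpilkaVolk2018, Cor. 34] -/
theorem sparseProduct_boolSum_not_equation_four {a n b q : ℕ} (hn : 8192 ≤ n)
    (hna : 10 * a + 2 ≤ n) (hb : 4 ≤ b) (H : MvPolynomial (degLEMonomials n ⊕ Fin q) ℂ)
    (k : ℕ) (E : Fin k → MvPolynomial (degLEMonomials n) ℂ) (hE : boolSum H = ∏ j, E j)
    (hEa : ∀ j, (E j).support.card ≤ Nat.choose (2 * n) n ^ a) (hne : boolSum H ≠ 0) :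
    ∃ f ∈ SmallCircuits ℂ n b,
      MvPolynomial.eval (coeffVector (degLEMonomials n) f) (boolSum H) ≠ 0 := by
  obtain ⟨f, hf, hf0⟩ :=
    isSuccinctHittingSet_sparseProducts_four_of_le hn hna (boolSum H) ⟨k, E, hE, hEa⟩ hne
  exact ⟨f, smallCircuits_mono ℂ hb (by omega) hf, hf0⟩

end GeneratorWall

end Summit.ValiantsHypothesis.ValiantsHypothesis.Theorems.BarrierLeverDefinableEquations

end
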